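import Mathlib.AlgebraicGeometry.EllipticCurve.Reduction
import Mathlib.RingTheory.DedekindDomain.AdicValuation
import Mathlib.NumberTheory.NumberField.Completion.FinitePlace
import Mathlib.RingTheory.DiscreteValuationRing.Basic
import Mathlib.RingTheory.Ideal.Norm.AbsNorm
import Mathlib.Algebra.BigOperators.Finprod
import Mathlib.NumberTheory.Padics.HeightOneSpectrum
import Mathlib.NumberTheory.NumberField.Basic
import Mathlib.Data.Nat.Factorization.Basic
import Literature.NumberTheory.DiophantineGeometry.LocalReduction
import HarnessLib

-- provenance: harness21/H21/H21/Prelude/DiophValNum/MinimalDiscriminant.lean @ 429c873 (interim HEAD d8f2665); M5 mechanical rewrite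
/-!
# The minimal discriminant of a Weierstrass curve

Trunk: `DiophValNum` (item C2 `MinimalDiscriminant`).

Let `A` be a Dedekind domain with fraction field `K`, `v : HeightOneSpectrum A` a finite place and
`W : WeierstrassCurve K`. As in `Literature.Prelude.DiophValNum.LocalReduction` (and Mathlib's
`WeierstrassCurve.LFunction`), the local ring at `v` is `O_v := v.adicCompletionIntegers K` inside
`K_v := v.adicCompletion K` (a discrete valuation ring, instance in
`Mathlib/NumberTheory/NumberField/Completion/FinitePlace.lean`), and local invariants of `W` at `v`
are computed on the integral minimal model `W.localMinimalIntegralModel v : WeierstrassCurve O_v`.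

This file provides the model-independent global glue:

* `WeierstrassCurve.ordMinimalDiscriminant v W : ℕ` — `ord_v (Δ_min)`, the `v`-adic order of the
  discriminant of a minimal Weierstrass equation at `v` (Silverman, AEC VII.1);
* `WeierstrassCurve.minimalDiscriminantIdeal A W : Ideal A` — the minimal discriminant ideal
  `𝔇_min = ∏_v 𝔭_v ^ ord_v (Δ_min)` (Silverman, AEC VIII.8);
* `WeierstrassCurve.minimalDiscriminantNorm A W : ℕ` — its absolute norm `N 𝔇_min`
  (`Ideal.absNorm`); for `A = ℤ` this is `|Δ_min (E)|`, for `A = 𝓞 K` it is `N_{K/ℚ} 𝔇_min`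
  (Oesterlé 1988, §2, the quantity in Szpiro's conjecture).

Mathlib has no notion of minimal discriminant (searched: `minimalDiscriminant`,
`MinimalDiscriminant`, `ordDiscriminant`); it does have all the local ingredients
(`WeierstrassCurve.IsMinimal`, `WeierstrassCurve.minimal`, `IsDiscreteValuationRing.addVal`,
`Ideal.absNorm`, `Rat.HeightOneSpectrum.natGenerator`, `Rat.ringOfIntegersEquiv`), which we use.

## Design notes

* All declarations live in `namespace WeierstrassCurve` (deliberate dot-notation extension of a
  Mathlib namespace, as in `LocalReduction`). `A` is implicit in declarations taking `v`, explicit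
  in the global ones (`W.minimalDiscriminantIdeal A`).
* Junk values: `IsDiscreteValuationRing.addVal O_v 0 = ⊤` and `(⊤ : ℕ∞).toNat = 0`, so
  `W.ordMinimalDiscriminant v = 0` iff `W` has good reduction at `v` **or** `Δ = 0`. Consequently
  for a singular `W` (`Δ = 0`) every exponent is `0`, `W.minimalDiscriminantIdeal A = 1 = ⊤` and
  `W.minimalDiscriminantNorm A = 1`; the infinite-support branch of `finprod` never occurs. Lemmas
  relating these to reduction types assume `[W.IsElliptic]`; lemmas comparing `𝔇_min` with
  `(Δ (W₀))` for a global minimal model `W₀` assume `W₀.Δ ≠ 0` (Mathlib's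
  `WeierstrassCurve.IsMinimal` does not exclude `Δ = 0`, and for `Δ = 0` the two sides are the junk
  `⊤` vs `⊥`); lemmas that hold unconditionally thanks to the junk values
  (`minimalDiscriminantIdeal_ne_bot`, `minimalDiscriminantNorm_pos`,
  `factorization_minimalDiscriminantNorm`) carry no ellipticity hypothesis.
* There is **no** global-minimality predicate and no existence theorem for global minimal models
  here; those are `WeierstrassCurve.IsGloballyMinimal` and
  `WeierstrassCurve.hasGlobalMinimalModel_of_isPrincipalIdealRing` in
  `Literature.Prelude.TranscendEllArithS.GlobalMinimalModel` (not imported here, to keep the dependency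
  direction `DiophValNum → TranscendEllArithS` free). Where needed the hypothesis is written inline
  as `∀ v, W.IsMinimalAt v` (the field `IsGloballyMinimal.isMinimal` for `A = 𝓞 K`).
* `Ideal.absNorm` only needs `[Module.Free ℤ A]`; `[Module.Finite ℤ A]` is added only on lemmas
  needing it.

## References

* J. H. Silverman, *The Arithmetic of Elliptic Curves*, GTM 106, 2nd ed. 2009, §VII.1 (Prop. 1.3),
  §VIII.8 (minimal discriminant).
* J. Oesterlé, *Nouvelles approches du «théorème» de Fermat*, Sém. Bourbaki 694, 1988, §2.
-/

open IsDedekindDomain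

namespace WeierstrassCurve

section Local

variable {A : Type*} [CommRing A] [IsDedekindDomain A] {K : Type*} [Field K]
  [Algebra A K] [IsFractionRing A K] (v : HeightOneSpectrum A) (W : WeierstrassCurve K)

/-- `W.ordMinimalDiscriminant v = ord_v (Δ_min)`: the `v`-adic order of the discriminant of a
minimal Weierstrass equation for `W` at the finite place `v`, computed as the additive valuation
(`IsDiscreteValuationRing.addVal`) on `O_v = v.adicCompletionIntegers K` of the discriminant of the
integral minimal model `W.localMinimalIntegralModel v`. It is independent of the chosen minimal
model (Silverman, AEC VII.1, Prop. 1.3(b)); see `ordMinimalDiscriminant_smul`.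
Junk value: if `Δ = 0` then `addVal 0 = ⊤` and `⊤.toNat = 0`, so the value is `0`.
Silverman, AEC VII.1 and VIII.8.
(Dot-notation extension of the Mathlib namespace `WeierstrassCurve`.) [folklore] -/
noncomputable def ordMinimalDiscriminant : ℕ :=
  (IsDiscreteValuationRing.addVal (v.adicCompletionIntegers K)
    (W.localMinimalIntegralModel v).Δ).toNat

end Local

section Global

variable (A : Type*) [CommRing A] [IsDedekindDomain A] {K : Type*} [Field K]
  [Algebra A K] [IsFractionRing A K] (W : WeierstrassCurve K)

/-- `W.minimalDiscriminantIdeal A = 𝔇_min`: the minimal discriminant ideal of `W / K`, the ideal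
`∏_v 𝔭_v ^ ord_v (Δ_min)` of `A`, where `v` runs over the finite places (height-one primes) of `A`.
For an elliptic `W` the multiplicative support of the product is the finite set of bad places
(`finite_setOf_ordMinimalDiscriminant_ne_zero`), so `finprod` is a genuine finite product. For a
singular `W` (`Δ = 0`) every exponent is the junk value `0`, the support is empty and the product is
`1 = ⊤` (documented junk value; the infinite-support branch of `finprod` never occurs).
Silverman, AEC VIII.8 (definition of the minimal discriminant).
(Dot-notation extension of the Mathlib namespace `WeierstrassCurve`.) [folklore] -/
noncomputable def minimalDiscriminantIdeal : Ideal A :=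
  ∏ᶠ v : HeightOneSpectrum A, v.asIdeal ^ W.ordMinimalDiscriminant v

/-- `W.minimalDiscriminantNorm A = N (𝔇_min)`: the absolute norm (`Ideal.absNorm`, the cardinality
of `A ⧸ 𝔇_min`) of the minimal discriminant ideal of `W / K`. For `A = ℤ`, `K = ℚ` this is
`|Δ_min (E)|` (`minimalDiscriminantNorm_eq_natAbs`); for `A = 𝓞 K` it is `N_{K/ℚ} 𝔇_min`, the
quantity appearing in Szpiro's conjecture. Junk value `1` for singular `W`.
Silverman, AEC VIII.8; Oesterlé 1988, §2.
(Dot-notation extension of the Mathlib namespace `WeierstrassCurve`.) [cite: Oesterle1988, §2. (Dot-notation extension of the Mathl] -/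
noncomputable def minimalDiscriminantNorm [Module.Free ℤ A] : ℕ :=
  Ideal.absNorm (W.minimalDiscriminantIdeal A)

end Global

/-! ### API -/

section LocalAPI

variable {A : Type*} [CommRing A] [IsDedekindDomain A] {K : Type*} [Field K]
  [Algebra A K] [IsFractionRing A K] (v : HeightOneSpectrum A) (W : WeierstrassCurve K)

/-- `ord_v (Δ_min)` is an isomorphism invariant of `W / K`: it is unchanged under an admissible
change of variables `C • W`. Silverman, AEC VII.1, Prop. 1.3(b) (the minimal discriminant valuation
is unique). [cite: SilvermanAEC2009, VII.1 Prop. 1.3(b)] -/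
def ordMinimalDiscriminant_smul : Prop :=
  ∀ (C : VariableChange K),
    (C • W).ordMinimalDiscriminant v = W.ordMinimalDiscriminant v

variable {v W} in
/-- If `W` is itself a minimal Weierstrass equation at `v` (and `Δ ≠ 0`), then
`v (Δ) = exp (-ord_v (Δ_min))` in the value group `ℤᵐ⁰` of `v.valuation K`, i.e.
`ord_v (Δ (W)) = ord_v (Δ_min)`. Silverman, AEC VII.1, Prop. 1.3. [cite: SilvermanAEC2009, VII.1 Prop. 1.3] -/
def valuation_Δ_eq_of_isMinimalAt : Prop :=
  ∀ [W.IsElliptic] (h : W.IsMinimalAt v),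
    v.valuation K W.Δ = WithZero.exp (-(W.ordMinimalDiscriminant v : ℤ))

/-- For an elliptic `W`, `ord_v (Δ_min) = 0` iff `W` has good reduction at `v`.
Silverman, AEC VII.5, Prop. 5.1(a). [cite: SilvermanAEC2009, VII.5 Prop. 5.1(a)] -/
def ordMinimalDiscriminant_eq_zero_iff : Prop :=
  ∀ [W.IsElliptic],
    W.ordMinimalDiscriminant v = 0 ↔ W.HasGoodReductionAt v

/-- For an elliptic `W`, `ord_v (Δ_min) ≠ 0` for only finitely many finite places `v` (namely the
bad places, `WeierstrassCurve.finite_badPlaces`). Silverman, AEC VII.5 and VIII.8. [cite: SilvermanAEC2009, VII.5 and VIII.8] -/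
def finite_setOf_ordMinimalDiscriminant_ne_zero : Prop :=
  ∀ [W.IsElliptic],
    {v : HeightOneSpectrum A | W.ordMinimalDiscriminant v ≠ 0}.Finite

end LocalAPI

section GlobalAPI

variable (A : Type*) [CommRing A] [IsDedekindDomain A] {K : Type*} [Field K]
  [Algebra A K] [IsFractionRing A K] (W : WeierstrassCurve K)

/-- The minimal discriminant ideal is an isomorphism invariant of `W / K`.
Silverman, AEC VII.1, Prop. 1.3(b) and VIII.8. [folklore] -/
def minimalDiscriminantIdeal_smul : Prop :=
  ∀ (C : VariableChange K),
    (C • W).minimalDiscriminantIdeal A = W.minimalDiscriminantIdeal A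

/- interim proof relied on results that are now named facts (D-0014); demoted to a fact by the M5 import, proof preserved:
:= by
  simp only [minimalDiscriminantIdeal, ordMinimalDiscriminant_smul]
-/

/-- The minimal discriminant ideal is nonzero. For an elliptic `W` this is Silverman, AEC VIII.8;
for a singular `W` it holds by the documented junk value `𝔇_min = ⊤`, so no `[W.IsElliptic]`
hypothesis is needed. [cite: SilvermanAEC2009, VIII.8] -/
def minimalDiscriminantIdeal_ne_bot : Prop :=
  W.minimalDiscriminantIdeal A ≠ ⊥

/-- For a global minimal Weierstrass equation `W₀` over `A` (minimal at every finite place) with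
nonzero discriminant, the minimal discriminant ideal is the principal ideal generated by its
discriminant: `𝔇_min = (Δ (W₀))`. The hypothesis `hΔ : W₀.Δ ≠ 0` is necessary: for `Δ = 0` every
integral model is minimal, the left-hand side is the junk value `⊤` and the right-hand side is `⊥`.
Silverman, AEC VIII.8 (remark following the definition of the minimal discriminant). [cite: SilvermanAEC2009, VIII.8 (remark following the definition of the minimal discriminant)] -/
def minimalDiscriminantIdeal_eq_span : Prop :=
  ∀ (W₀ : WeierstrassCurve A) (hΔ : W₀.Δ ≠ 0) (h : ∀ v : HeightOneSpectrum A, (W₀.baseChange K).IsMinimalAt v),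
    (W₀.baseChange K).minimalDiscriminantIdeal A = Ideal.span {W₀.Δ}

end GlobalAPI

section Rat

variable (W : WeierstrassCurve ℚ)

/-- Over `ℤ ⊆ ℚ`: for a global minimal Weierstrass equation `W₀` over `ℤ` with nonzero
discriminant, the norm of the minimal discriminant ideal is `|Δ (W₀)| = |Δ_min|`. The hypothesis
`hΔ : W₀.Δ ≠ 0` is necessary: for `Δ = 0` the left-hand side is the junk value `1` and the
right-hand side is `0`. Silverman, AEC VIII.8 (over `ℚ` a global minimal model exists, Cor. 8.3). [cite: SilvermanAEC2009, VIII.8 and Cor. 8.3] -/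
def minimalDiscriminantNorm_eq_natAbs : Prop :=
  ∀ (W₀ : WeierstrassCurve ℤ) (hΔ : W₀.Δ ≠ 0) (h : ∀ v : HeightOneSpectrum ℤ, (W₀.baseChange ℚ).IsMinimalAt v),
    (W₀.baseChange ℚ).minimalDiscriminantNorm ℤ = W₀.Δ.natAbs

/-- Over `ℤ ⊆ ℚ`: the minimal discriminant `|Δ_min|` of `W / ℚ` is positive. For an elliptic `W`
this is Silverman, AEC VIII.8; for a singular `W` it holds by the junk value `1`, so no
`[W.IsElliptic]` hypothesis is needed. [cite: SilvermanAEC2009, VIII.8] -/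
def minimalDiscriminantNorm_pos : Prop :=
  0 < W.minimalDiscriminantNorm ℤ

/-- Over `ℤ ⊆ ℚ`: the exponent of the prime `p` below `v` in `|Δ_min|` is `ord_v (Δ_min)`, i.e.
`|Δ_min| = ∏_p p ^ ord_p (Δ_min)` (`Rat.HeightOneSpectrum.natGenerator v` is the prime generating
`v.asIdeal`). Holds unconditionally (for singular `W` both sides are the junk value `0`), so no
`[W.IsElliptic]` hypothesis is needed. Silverman, AEC VIII.8. [cite: SilvermanAEC2009, VIII.8] -/
def factorization_minimalDiscriminantNorm : Prop :=
  ∀ (v : HeightOneSpectrum ℤ),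
    (W.minimalDiscriminantNorm ℤ).factorization (Rat.HeightOneSpectrum.natGenerator v) =
      W.ordMinimalDiscriminant v

open NumberField in
/-- Bridge between the two integer rings of `ℚ`: the minimal discriminant norm of `W / ℚ` computed
over `A = 𝓞 ℚ` agrees with the one computed over `A = ℤ` (transport along
`Rat.ringOfIntegersEquiv : 𝓞 ℚ ≃+* ℤ`). This connects the present file with the `A = 𝓞 K`
conventions of `Literature.Prelude.TranscendEllArithS.GlobalMinimalModel`. Silverman, AEC VIII.8. [folklore] -/
def minimalDiscriminantNorm_ringOfIntegers_rat : Prop :=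
  W.minimalDiscriminantNorm (𝓞 ℚ) = W.minimalDiscriminantNorm ℤ

end Rat

end WeierstrassCurve
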